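import Summits.ResolutionOfSingularities.ResolutionOfSingularities.Theorems.FrobeniusLadderFInjectiveMacaulayficationDeformation
import Summits.ResolutionOfSingularities.ResolutionOfSingularities.Theorems.FrobeniusLadderFInjectiveMacaulayficationExtendSop
import Summits.ResolutionOfSingularities.ResolutionOfSingularities.Theorems.FrobeniusLadderFInjectiveMacaulayficationPartialSop
import HarnessLib

/-!
# LEMMA D — (H1′) and (H2) of LEMMA L′ at one local ring of the cover, from «CMFI deforms» and a partial system of parameters
(crux `FInjectiveMacaulayfication`, stmt-ResolutionOfSingularities-15315; line `H4LocRepair`, door v30 `stub_closedCentreExists`;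
typed ladder of record for line (Q) = THEOREM Q♮ of the dim ≥ 4 census `ROUTES-DIM4.md` §1-ter/§1-quater, RULING R15.1 (2):
Q♮ = LEMMA L′ (`…LemmaLPrime.cmcl_and_fcl_of_split`) + (D1) «cone chart CM ⇒ (H1′)» + (D2) «cone chart CMFI ⇒ (H2)»; this file is
(D1) ∧ (D2) MERGED at the ring level)

Support file (helper; proves no registered stub by name).  Let `(B, 𝔪_B)` be a Noetherian local ring of prime characteristic `p` and
`x ∈ 𝔪_B` a non-zero-divisor such that `B/xB` satisfies the crux's stalk clause (every system of parameters weakly regular and generating a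
Frobenius closed ideal — "CMFI" in clause form).  Then every PARTIAL system of parameters `s : Fin d → B` (`dim B = d + e`,
`dim B/(s) = e`) is a weakly regular sequence on `B` and `(s)B` is Frobenius closed (inline form) — `partial_clause_of_deforms`.  Without
the Frobenius side: if `B` satisfies the CM clause then every partial system of parameters is weakly regular — `partial_isWeaklyRegular_of_cmcl`.

In THEOREM Q♮ this is applied to `B = A'_𝔑`, the localisation of the `𝔾_m`-cover chart ring `A' ⊇ C = 𝒪_{Y,y}` at a maximal ideal
`𝔑 ∋ t⁻¹`, with `x = t⁻¹` (the Rees deformation parameter: `B/t⁻¹B` is a localisation of the cone chart `G[ū⁻¹]`, CMFI by hypothesis)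
and `s` = the image of a system of parameters of `C` (a PARTIAL system of parameters of `B` by the fibre-height count — the degree-`w` unit);
the conclusions are exactly the hypotheses (H1′) at `𝔑` and (H2) at `𝔑` of LEMMA L′.  At the maximal ideals `𝔑 ∌ t⁻¹` (which lie over
non-maximal primes of `C`, hence over generizations of `b`, FULL in the door) only (H1′) is needed and `partial_isWeaklyRegular_of_cmcl`
supplies it.

Proof: `Deformation.cmfi_of_cmfi_quotient` [Fedder 1983, Thm. 3.4 (1)] makes `B` CMFI (clause form); `ExtendSop.stub_extendSop` extends
`s` to a system of parameters `Fin.append s t`; `PartialSop.stub_partialSop` (prefix of a weakly regular sequence; Krull intersection for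
the Frobenius closure) gives the two conclusions for the initial segment `s`.  All three are tree theorems; no named facts.

NEAREST TREE LEMMAS (dedup check of RULING R15.5 (2), res-L1-w45a-plan-1, after res-L1-w45a-tri-2's prior-art audit): (i) E1-type
`ConeFibreClause.clause_atMaximal_of_fibreSurjection` (deformation across a principal fibre at the maximal ideals `Q ∋ s` of a Noetherian
DOMAIN `T` with `T/(s) ≅ F` CMFI at its maximal ideals ⇒ `T_Q` a domain satisfying the FULL clause) — LEMMA D differs by working in
one abstract local ring `B` (no domain / surjection / global fibre hypotheses) and by concluding for PARTIAL systems of parameters, the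
currency (H1′)/(H2) of LEMMA L′ (`…LemmaLPrime.cmcl_and_fcl_of_split`); (ii) E4's `DegreeZeroDescent.images_clause_of_ringKrullDim`
(full clause of `L` + `dim L = d + e`, `dim L/(s′) = e` ⇒ clause for the partial system `s′`) — the body below is, up to the
`IsFrobeniusClosed` repackaging, `images_clause_of_ringKrullDim ∘ Deformation.cmfi_of_cmfi_quotient`; the merged statement is filed
because the (Q)-ladder consumers (`H4LocRepairSig` v1.14 §10⁶ `lemmaD`/`lemmaD₀`) cite it by this name and shape.  Text: res-L1-w45a-strat-1
`LemmaD-v1-1b2b0104098a997b.lean` verbatim; filer res-L1-w45a-stub-4 g6.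

## References
* [Fedder1983] R. Fedder, *F-purity and rational singularity*, Trans. Amer. Math. Soc. 278 (1983) 461–480, Thm. 3.4 (1).
* [QuyShimomoto2017] P. H. Quy, K. Shimomoto, *F-injectivity and Frobenius closure of ideals in Noetherian rings of characteristic
  p > 0*, Adv. Math. 313 (2017) 127–166, §3.
* [BrunsHerzog1998] W. Bruns, J. Herzog, *Cohen–Macaulay rings*, rev. ed. 1998, §1.5–§2.1 (systems of parameters, regular sequences).
-/

-- single-problem summit: the doubled namespace component is forced
set_option linter.dupNamespace false

namespace Summit.ResolutionOfSingularities.ResolutionOfSingularities.Theorems.FInjectiveMacaulayfication.PartialClauseDeforms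

open IsLocalRing RingTheory.Sequence Literature.RingTheory.TightClosure

/-- **LEMMA D.** `B` Noetherian local of characteristic `p`, `x ∈ 𝔪_B` a non-zero-divisor with `B/xB` CMFI (clause form) ⇒ every
partial system of parameters `s` of `B` (`dim B = d + e`, `dim B/(s) = e`) is a weakly regular sequence and generates a Frobenius closed
ideal — (H1′) and (H2) of LEMMA L′ at `B`. [OURS; assembly of tree theorems] -/
theorem partial_clause_of_deforms (p : ℕ) [Fact p.Prime] (B : Type) [CommRing B] [IsNoetherianRing B]
    [IsLocalRing B] [CharP B p] (x : B) (hxm : x ∈ maximalIdeal B) (hx0 : x ∈ nonZeroDivisors B)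
    (hq : ∀ d : ℕ, ringKrullDim (B ⧸ Ideal.span {x}) = d → ∀ s : Fin d → B ⧸ Ideal.span {x},
      (Ideal.span (Set.range s)).radical.IsMaximal →
        IsWeaklyRegular (B ⧸ Ideal.span {x}) (List.ofFn s) ∧
        ∀ y : B ⧸ Ideal.span {x}, (∃ e : ℕ, y ^ p ^ e ∈ Ideal.span ((fun z : B ⧸ Ideal.span {x} => z ^ p ^ e) ''
          (Ideal.span (Set.range s) : Set (B ⧸ Ideal.span {x})))) → y ∈ Ideal.span (Set.range s))
    (d e : ℕ) (s : Fin d → B) (hdim : ringKrullDim B = ((d + e : ℕ) : WithBot ℕ∞))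
    (hquot : ringKrullDim (B ⧸ Ideal.span (Set.range s)) = (e : WithBot ℕ∞)) :
    IsWeaklyRegular B (List.ofFn s) ∧
      ∀ z : B, (∃ e' : ℕ, z ^ p ^ e' ∈ Ideal.span ((fun w : B => w ^ p ^ e') '' (Ideal.span (Set.range s) : Set B))) →
        z ∈ Ideal.span (Set.range s) := by
  -- CMFI(B) in clause form, by deformation
  have hB := Deformation.cmfi_of_cmfi_quotient p B x hxm hx0 hq
  -- … in `IsSystemOfParameters` form
  have hB' : ∀ ⦃n : ℕ⦄ (u : Fin n → B), IsSystemOfParameters u →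
      IsWeaklyRegular B (List.ofFn u) ∧ IsFrobeniusClosed p (Ideal.span (Set.range u)) := by
    intro n u hu
    obtain ⟨hn, hrad⟩ := isSystemOfParameters_iff.mp hu
    obtain ⟨hw, hf⟩ := hB n hn u hrad
    exact ⟨hw, (isFrobeniusClosed_iff p).mpr hf⟩
  -- extend `s` to a system of parameters and take the initial segment
  obtain ⟨t, hst⟩ := ExtendSop.stub_extendSop B d e s hdim hquot
  obtain ⟨hw, hf⟩ := PartialSop.stub_partialSop p B hB' d e s t hst
  exact ⟨hw, (isFrobeniusClosed_iff p).mp hf⟩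

/-- **LEMMA D₀ (CM side only).** In a Noetherian local ring satisfying the CM clause (every system of parameters weakly regular), every
partial system of parameters (`dim B = d + e`, `dim B/(s) = e`) is a weakly regular sequence — (H1′) of LEMMA L′ at the maximal ideals
of the cover away from `t⁻¹`. [OURS; assembly of tree theorems] -/
theorem partial_isWeaklyRegular_of_cmcl (B : Type) [CommRing B] [IsNoetherianRing B] [IsLocalRing B]
    (hCM : ∀ d : ℕ, ringKrullDim B = d → ∀ s : Fin d → B, (Ideal.span (Set.range s)).radical.IsMaximal →
      IsWeaklyRegular B (List.ofFn s))
    (d e : ℕ) (s : Fin d → B) (hdim : ringKrullDim B = ((d + e : ℕ) : WithBot ℕ∞))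
    (hquot : ringKrullDim (B ⧸ Ideal.span (Set.range s)) = (e : WithBot ℕ∞)) :
    IsWeaklyRegular B (List.ofFn s) := by
  obtain ⟨t, hst⟩ := ExtendSop.stub_extendSop B d e s hdim hquot
  obtain ⟨hn, hrad⟩ := isSystemOfParameters_iff.mp hst
  have hreg := hCM (d + e) hn (Fin.append s t) hrad
  rw [List.ofFn_fin_append] at hreg
  exact ((isWeaklyRegular_append_iff B (List.ofFn s) (List.ofFn t)).mp hreg).1

end Summit.ResolutionOfSingularities.ResolutionOfSingularities.Theorems.FInjectiveMacaulayfication.PartialClauseDeforms
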